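import Summits.KontsevichZagierPeriods.KontsevichZagierPeriods.Theorems.SoloInformedAnNu
import HarnessLib

/-!
# The DEN-calculus over `K`: the measure drops along a pure-cone blow-up

Solo programme `solo-KontsevichZagierPeriods-informed`, session s107, step (x-q) of the general
two-dimensional algorithm — the **drop lemma**.  Let `F` have multiplicity `m = k + 1` at `0`, cone
`c (X − θ)^m` with `c ≠ 0`, `θ ≥ 0`, and an isolated zero at `0` on the unit square; let
`G = child_F(θ, κ, λ)` (`κ > 0`, `λ ≠ 0`) have multiplicity `m` again.  Then `ν(G) < ν(F)`.

Proof.  `h = ∂₁^k F` has linear part `m! c (x₁ − θ x₀)`, so the maximal-contact curve `φ` of `F`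
exists, `φ'(0) = θ`, `φ = x φ₁(x)`.  The maximal-contact polynomial of `G` is `λ^k child_h(θ,κ,λ)`,
and `ψ(x) := (φ₁(κx) − θ)/λ` is a branch of its zero set; by branch independence
`ν(G) = (ord₀ G(x, ψ x), ord₀ ψ)`.  From `(κx)^m G(x, ψ x) = F(κx, φ(κx))` we get
`m + ord₀ G(x,ψ x) = ord₀ F(s, φ s)`: if the latter is finite the first component drops; if it is
infinite, the isolated zero forces `θ = 0` and `φ₁ ≢ 0`, and then `ord₀ ψ = ord₀ φ₁ < 1 + ord₀ φ₁ =
ord₀ φ`.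

References: J. Kollár, *Lectures on Resolution of Singularities* (2007), §1.10.
-/

noncomputable section

open scoped BigOperators Topology ContDiff
open Filter Polynomial Set

namespace Summit.KontsevichZagierPeriods.KontsevichZagierPeriods.Theorems

variable {K : Type*} [Field K] [Algebra K ℝ]

/-! ### Preliminaries -/

/-- Values of a constant multiple. [this work] -/
theorem soloInformed_evalR_C_mul (a : K) (P : MvPolynomial (Fin 2) K) (q : ℝ × ℝ) :
    soloInformedEvalR (MvPolynomial.C a * P) q = algebraMap K ℝ a * soloInformedEvalR P q := by
  rw [soloInformed_evalR_apply, soloInformed_evalR_apply, map_mul, MvPolynomial.aeval_C]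

/-- Factorials are non-zero in `K` (a subfield of `ℝ`). [this work] -/
theorem soloInformed_natCast_factorial_ne_zero (n : ℕ) : ((n.factorial : ℕ) : K) ≠ 0 := by
  intro h
  have h' := congrArg (algebraMap K ℝ) h
  rw [map_natCast, map_zero] at h'
  exact (Nat.cast_ne_zero.2 (Nat.factorial_ne_zero n)) h'

/-- The contact condition for an `F` with pure cone `c (X − θ)^{k+1}`, `c ≠ 0`. [this work] -/
theorem soloInformed_contactOK_of_pureCone {F : MvPolynomial (Fin 2) K} {k : ℕ}
    (hmult : soloInformedMultK F = k + 1) {c θ : K} (hc : c ≠ 0)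
    (hcone : soloInformedConePolyK F (k + 1) = C c * (X - C θ) ^ (k + 1)) :
    SoloInformedContactOK F := by
  apply soloInformed_contactOK_of_coeff
  rw [soloInformed_maxContactK_eq hmult,
    soloInformed_coeff_single_one_maxContact_of_pow (soloInformed_le_deg_of_multK_eq hmult) hcone]
  exact mul_ne_zero (soloInformed_natCast_factorial_ne_zero _) hc

/-- The contact condition for a child of the same multiplicity of such an `F`. [this work] -/
theorem soloInformed_contactOK_childK_of_pureCone {F : MvPolynomial (Fin 2) K} {k : ℕ} {c θ : K}
    (hc : c ≠ 0) (hcone : soloInformedConePolyK F (k + 1) = C c * (X - C θ) ^ (k + 1))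
    {κ lam : K} (hlam : lam ≠ 0)
    (hmultC : soloInformedMultK (soloInformedChildK F (k + 1) θ κ lam) = k + 1) :
    SoloInformedContactOK (soloInformedChildK F (k + 1) θ κ lam) := by
  apply soloInformed_contactOK_of_coeff
  rw [soloInformed_maxContactK_eq hmultC, soloInformed_coeff_single_one_iterate_pderiv,
    soloInformed_coeff_childK_of_pow hcone κ lam]
  exact mul_ne_zero (soloInformed_natCast_factorial_ne_zero _) (mul_ne_zero hc (pow_ne_zero _ hlam))

/-- A point `(s, w)` with `0 < s ≤ 1`, `0 ≤ w ≤ 1` is a non-zero point of the unit square.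
[this work] -/
theorem soloInformed_pair_mem_cube {s w : ℝ} (hs0 : 0 < s) (hs1 : s ≤ 1) (hw0 : 0 ≤ w)
    (hw1 : w ≤ 1) : (![s, w] : Fin 2 → ℝ) ∈ soloInformedCube 2 ∧ (![s, w] : Fin 2 → ℝ) ≠ 0 := by
  refine ⟨fun j => ?_, fun h => hs0.ne' ?_⟩
  · fin_cases j
    · exact ⟨hs0.le, hs1⟩
    · exact ⟨hw0, hw1⟩
  · simpa using congr_fun h 0

/-- The analytic order of `x ↦ κ x` at `0` is `1` and of `x ↦ (κ x)^m` is `m` (`κ ≠ 0`).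
[this work] -/
theorem soloInformed_analyticOrderAt_mul_pow {κ : ℝ} (hκ : κ ≠ 0) (m : ℕ) :
    analyticOrderAt (fun x : ℝ => (κ * x) ^ m) 0 = m := by
  have hg : AnalyticAt ℝ (fun x : ℝ => κ * x) 0 := analyticAt_const.mul analyticAt_id
  have hg' : deriv (fun x : ℝ => κ * x) 0 = κ := by simp
  have h1 : analyticOrderAt (fun x : ℝ => κ * x) 0 = 1 := by
    have h := hg.analyticOrderAt_sub_eq_one_of_deriv_ne_zero (by rw [hg']; exact hκ)
    simpa using h
  change analyticOrderAt ((fun x : ℝ => κ * x) ^ m) 0 = m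
  rw [analyticOrderAt_pow hg, h1, nsmul_eq_mul, mul_one]

/-- The analytic order is unchanged by the substitution `x ↦ κ x` (`κ ≠ 0`). [this work] -/
theorem soloInformed_analyticOrderAt_comp_mul (f : ℝ → ℝ) {κ : ℝ} (hκ : κ ≠ 0) :
    analyticOrderAt (fun x : ℝ => f (κ * x)) 0 = analyticOrderAt f 0 := by
  have hg : AnalyticAt ℝ (fun x : ℝ => κ * x) 0 := analyticAt_const.mul analyticAt_id
  have hg' : deriv (fun x : ℝ => κ * x) 0 = κ := by simp
  have h := analyticOrderAt_comp_of_deriv_ne_zero (f := f) hg (by rw [hg']; exact hκ)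
  rw [mul_zero] at h
  exact h

/-- The analytic order is unchanged by a non-zero constant factor. [this work] -/
theorem soloInformed_analyticOrderAt_mul_const {f : ℝ → ℝ} (hf : AnalyticAt ℝ f 0) {a : ℝ}
    (ha : a ≠ 0) : analyticOrderAt (fun x => f x * a) 0 = analyticOrderAt f 0 := by
  change analyticOrderAt (f * fun _ => a) 0 = _
  rw [analyticOrderAt_mul hf analyticAt_const,
    (analyticOrderAt_eq_zero (f := fun _ : ℝ => a) (z₀ := (0 : ℝ))).2 (Or.inr ha), add_zero]

/-! ### The drop lemma -/

/-- **The drop lemma.**  For `F` of multiplicity `k + 1` with pure cone `c (X − θ)^{k+1}`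
(`c ≠ 0`, `θ ≥ 0`) and an isolated zero at the origin of the unit square, every child germ
`child_F(θ, κ, λ)` (`κ > 0`, `λ ≠ 0`) of the same multiplicity has strictly smaller secondary
measure `ν`. [this work] -/
theorem soloInformed_nuK_childK_lt {F : MvPolynomial (Fin 2) K} {k : ℕ}
    (hmult : soloInformedMultK F = k + 1) {c θ : K} (hc : c ≠ 0) (hθ : 0 ≤ algebraMap K ℝ θ)
    (hcone : soloInformedConePolyK F (k + 1) = C c * (X - C θ) ^ (k + 1))
    (hF : ∀ y ∈ soloInformedCube 2, y ≠ 0 → (MvPolynomial.aeval y F : ℝ) ≠ 0)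
    {κ lam : K} (hκ : 0 < algebraMap K ℝ κ) (hlam : algebraMap K ℝ lam ≠ 0)
    (hmultC : soloInformedMultK (soloInformedChildK F (k + 1) θ κ lam) = k + 1) :
    soloInformedNuK (soloInformedChildK F (k + 1) θ κ lam) < soloInformedNuK F := by
  -- notation
  set m := k + 1 with hmdef
  set κ' := algebraMap K ℝ κ with hκ'
  set lam' := algebraMap K ℝ lam with hlam'
  set θ' := algebraMap K ℝ θ with hθ'
  have hlamK : lam ≠ 0 := fun h => hlam (by rw [hlam', h, map_zero])
  have hκ0 : κ' ≠ 0 := hκ.ne'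
  have hm := soloInformed_le_deg_of_multK_eq hmult
  set G := soloInformedChildK F m θ κ lam with hGdef
  set h := (MvPolynomial.pderiv 1)^[k] F with hhdef
  have hmaxF : soloInformedMaxContactK F = h := soloInformed_maxContactK_eq hmult
  have hm_h : ∀ b ∈ h.support, 1 ≤ b 0 + b 1 := by
    have h' := soloInformed_le_deg_iterate_pderiv hm k
    rwa [hmdef, Nat.add_sub_cancel_left] at h'
  have hmaxG : soloInformedMaxContactK G = MvPolynomial.C (lam ^ k) * soloInformedChildK h 1 θ κ lam := by
    rw [soloInformed_maxContactK_eq hmultC, hGdef, soloInformed_iterate_pderiv_childK F hm θ κ lam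
      (Nat.le_succ k), hmdef, Nat.add_sub_cancel_left]
  have hfac : ((m.factorial : ℕ) : ℝ) * algebraMap K ℝ c ≠ 0 :=
    mul_ne_zero (Nat.cast_ne_zero.2 (Nat.factorial_ne_zero _)) ((_root_.map_ne_zero _).2 hc)
  -- the maximal-contact curve of `F`
  have HF := soloInformed_contactOK_of_pureCone hmult hc hcone
  obtain ⟨φ, hφan, hφ0, hφev, hφder, hνF⟩ :=
    soloInformed_exists_contactCurve HF (soloInformed_evalR_maxContactK_zero hmult)
  rw [hmaxF] at hφev hφder
  rw [soloInformed_coeff_single_zero_maxContact_of_pow hm hcone,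
    soloInformed_coeff_single_one_maxContact_of_pow hm hcone, map_neg, map_mul, map_mul,
    map_natCast] at hφder
  have hderiv : deriv φ 0 = θ' := by
    have h1 : ((m.factorial : ℕ) : ℝ) * algebraMap K ℝ c * (deriv φ 0 - θ') = 0 := by
      rw [hθ']; linear_combination hφder
    rcases mul_eq_zero.1 h1 with h2 | h2
    · exact absurd h2 hfac
    · linarith
  obtain ⟨hφ₁an, hφfac, hφ₁0⟩ := soloInformed_dslope_spec hφan hφ0
  set φ₁ := dslope φ 0 with hφ₁def
  rw [hderiv] at hφ₁0
  -- the branch `ψ` of the maximal-contact polynomial of `G`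
  set ψ : ℝ → ℝ := fun x => (φ₁ (κ' * x) - θ') / lam' with hψdef
  have hψ0 : ψ 0 = 0 := by simp [hψdef, hφ₁0]
  have hφ₁κ : AnalyticAt ℝ (fun x => φ₁ (κ' * x)) 0 :=
    AnalyticAt.comp_of_eq hφ₁an (analyticAt_const.mul analyticAt_id) (by simp)
  have hψan : AnalyticAt ℝ ψ 0 := (hφ₁κ.sub analyticAt_const).div analyticAt_const (by exact hlam)
  have hkey : ∀ x : ℝ, κ' * x * (θ' + lam' * ψ x) = φ (κ' * x) := fun x => by
    rw [hψdef]
    simp only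
    rw [mul_div_cancel₀ _ hlam, add_sub_cancel, hφfac (κ' * x)]
  have htendκ : Tendsto (fun x : ℝ => κ' * x) (𝓝 0) (𝓝 0) := by
    simpa using (continuous_const_mul κ').tendsto (0 : ℝ)
  have hψbr : ∀ᶠ x in 𝓝 0, soloInformedEvalR (soloInformedMaxContactK G) (x, ψ x) = 0 := by
    filter_upwards [htendκ.eventually hφev] with x hx
    by_cases hx0 : x = 0
    · rw [hx0, hψ0]; exact soloInformed_evalR_maxContactK_zero hmultC
    · rw [hmaxG, soloInformed_evalR_C_mul]
      have hval := soloInformed_pow_mul_evalR_childK h hm_h θ κ lam x (ψ x)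
      rw [pow_one, ← hκ', ← hθ', ← hlam', hkey x, hx] at hval
      rcases mul_eq_zero.1 hval with h1 | h1
      · exact absurd h1 (mul_ne_zero hκ0 hx0)
      · rw [h1, mul_zero]
  have hνG := soloInformed_nuK_eq_of_branch
    (soloInformed_contactOK_childK_of_pureCone hc hcone hlamK hmultC)
    (soloInformed_evalR_maxContactK_zero hmultC) hψ0 hψan.continuousAt hψbr
  -- the orders along the branches
  set J : ℝ → ℝ := fun s => soloInformedEvalR F (s, φ s) with hJdef
  set JG : ℝ → ℝ := fun x => soloInformedEvalR G (x, ψ x) with hJGdef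
  have hJan : AnalyticAt ℝ J 0 := (soloInformed_analyticAt_evalR F _).comp₂ analyticAt_id hφan
  have hJGan : AnalyticAt ℝ JG 0 := (soloInformed_analyticAt_evalR G _).comp₂ analyticAt_id hψan
  have hrel : (fun x : ℝ => (κ' * x) ^ m) * JG = fun x => J (κ' * x) := by
    funext x
    simp only [Pi.mul_apply, hJGdef, hJdef]
    rw [← hkey x]
    exact soloInformed_pow_mul_evalR_childK F hm θ κ lam x (ψ x)
  have hpowan : AnalyticAt ℝ (fun x : ℝ => (κ' * x) ^ m) 0 :=
    (analyticAt_const.mul analyticAt_id).pow m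
  have hord : (m : ℕ∞) + analyticOrderAt JG 0 = analyticOrderAt J 0 := by
    rw [← soloInformed_analyticOrderAt_comp_mul J hκ0, ← hrel, analyticOrderAt_mul hpowan hJGan,
      soloInformed_analyticOrderAt_mul_pow hκ0]
  rw [hνG, hνF, Prod.Lex.toLex_lt_toLex]
  by_cases htop : analyticOrderAt J 0 = ⊤
  · -- `F` vanishes along its maximal-contact curve: then `θ = 0` and the second component drops
    right
    have hGtop : analyticOrderAt JG 0 = ⊤ := by
      rw [htop, ENat.add_eq_top] at hord
      exact hord.resolve_left (ENat.coe_ne_top m)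
    refine ⟨by rw [hGtop, htop], ?_⟩
    have hJev : ∀ᶠ s in 𝓝 0, J s = 0 := analyticOrderAt_eq_top.1 htop
    have hs1 : ∀ᶠ s : ℝ in 𝓝 0, s < 1 := Iio_mem_nhds zero_lt_one
    have hφ1 : ∀ᶠ s : ℝ in 𝓝 0, φ s < 1 := by
      have hc := hφan.continuousAt
      rw [ContinuousAt, hφ0] at hc
      exact hc.eventually (Iio_mem_nhds zero_lt_one)
    -- `θ = 0`
    have hθ0 : θ' = 0 := by
      by_contra hne
      have hpos : 0 < θ' := lt_of_le_of_ne hθ (Ne.symm hne)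
      have hφ₁pos : ∀ᶠ s : ℝ in 𝓝 0, 0 < φ₁ s := by
        have hc := hφ₁an.continuousAt
        rw [ContinuousAt, hφ₁0] at hc
        exact hc.eventually (Ioi_mem_nhds hpos)
      obtain ⟨s, ⟨hJs, hs1', hφ1', hφ₁s⟩, hs0⟩ :=
        (((hJev.and (hs1.and (hφ1.and hφ₁pos))).filter_mono nhdsWithin_le_nhds).and
          (self_mem_nhdsWithin (s := Ioi (0 : ℝ)))).exists
      have hφs : 0 < φ s := by rw [hφfac s]; exact mul_pos hs0 hφ₁s
      obtain ⟨hmem, hne0⟩ := soloInformed_pair_mem_cube hs0 hs1'.le hφs.le hφ1'.le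
      exact hF _ hmem hne0 hJs
    -- `φ₁ ≢ 0`
    have hφ₁top : analyticOrderAt φ₁ 0 ≠ ⊤ := by
      intro htop₁
      have hφ₁ev : ∀ᶠ s in 𝓝 0, φ₁ s = 0 := analyticOrderAt_eq_top.1 htop₁
      obtain ⟨s, ⟨hJs, hs1', hφ₁s⟩, hs0⟩ :=
        (((hJev.and (hs1.and hφ₁ev)).filter_mono nhdsWithin_le_nhds).and
          (self_mem_nhdsWithin (s := Ioi (0 : ℝ)))).exists
      have hφs : φ s = 0 := by rw [hφfac s, hφ₁s, mul_zero]
      obtain ⟨hmem, hne0⟩ := soloInformed_pair_mem_cube hs0 hs1'.le le_rfl zero_le_one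
      have h' : soloInformedEvalR F (s, φ s) = 0 := hJs
      rw [hφs] at h'
      exact hF _ hmem hne0 h'
    -- compare `ord ψ = ord φ₁` with `ord φ = 1 + ord φ₁`
    have hψord : analyticOrderAt ψ 0 = analyticOrderAt φ₁ 0 := by
      have hψ' : ψ = fun x => φ₁ (κ' * x) * lam'⁻¹ := by
        funext x; rw [hψdef]; simp only; rw [hθ0, sub_zero, div_eq_mul_inv]
      rw [hψ', soloInformed_analyticOrderAt_mul_const hφ₁κ (inv_ne_zero hlam),
        soloInformed_analyticOrderAt_comp_mul φ₁ hκ0]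
    have hφord : analyticOrderAt φ 0 = 1 + analyticOrderAt φ₁ 0 := by
      have hφ' : φ = id * φ₁ := by funext x; exact hφfac x
      rw [hφ', analyticOrderAt_mul analyticAt_id hφ₁an, analyticOrderAt_id]
    rw [hψord, hφord]
    obtain ⟨n, hn⟩ := ENat.ne_top_iff_exists.1 hφ₁top
    rw [← hn, show (1 : ℕ∞) + (n : ℕ∞) = ((1 + n : ℕ) : ℕ∞) by push_cast; rfl]
    exact Nat.cast_lt.2 (by omega)
  · -- the first component drops by `m ≥ 1`
    left
    obtain ⟨N, hN⟩ := ENat.ne_top_iff_exists.1 htop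
    have hGtop : analyticOrderAt JG 0 ≠ ⊤ := by
      intro h'
      rw [h', add_top] at hord
      exact htop hord.symm
    obtain ⟨n, hn⟩ := ENat.ne_top_iff_exists.1 hGtop
    rw [← hn, ← hN] at hord ⊢
    rw [show (m : ℕ∞) + (n : ℕ∞) = ((m + n : ℕ) : ℕ∞) by push_cast; rfl] at hord
    have hmn : m + n = N := by exact_mod_cast hord
    exact Nat.cast_lt.2 (by omega)

end Summit.KontsevichZagierPeriods.KontsevichZagierPeriods.Theorems
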